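import Summits.Schanuel.Schanuel.Theorems.ZilberEacNewtonLowerEdge
import Summits.Schanuel.Schanuel.Theorems.ZilberEacPlaceLatticeTransport
import Summits.Schanuel.Schanuel.Theorems.ZilberEacRelationPuiseux
import Summits.Schanuel.Schanuel.Theorems.ZilberEacFibreCurvePuiseux
import HarnessLib

/-!
# The exponential-polynomial regime, CXXV: TRANSPORT OF A FIBRE RELATION TO ITS LOWER EDGE

HONEST FRAMING.  Cell `pub-schanuel` (Zilber's Exponential-Algebraic Closedness, case ladder;
host summit Schanuel), seat 2, gen 35.  The algebraic half of the complete verdict over curves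
with an equal-order place of non-real direction (O93).  Given a relation
`P ∈ ℂ[x₀, x₁, y₁][y₀]` of positive degree whose top and constant coefficients are not
divisible by the curve polynomial `F` (the minimal fibre polynomial of a surface of
Mantova–Masser's case), write `P ≡ Σ_{(i,j) ∈ S} P_{ij}(x) y₀^i y₁^j (mod F)` with `S` the
support modulo `F`; choose a lower edge `ℓ(i,j) = a j − b i` of `S` (file CXXI) and a sign
`ε = ±1` PRESCRIBED BY THE CALLER through a function of `(a, b, c, d)`; with
`U = (εa εb; c d)`, `V = U⁻¹ = (εd −b; −εc a)` transport: `G'(x', y₁'; y₀') = Σ_S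
P_{ij}(Vx') y₀'^{ε(di − cj) + n₀} y₁'^{ℓ(i,j) − ℓ_min}` is a polynomial whose degenerate part
`G₀' = G'(x', 0; y₀')` has two coefficients not divisible by the transported curve polynomial
`F' = τF`, and on the torus `G'(x', y₁'; y₀') = y₀'^{n₀} y₁'^{−ℓ_min} P(Vx', y₀'^{−εc}y₁'^{a};
y₀'^{εd} y₁'^{−b})` at points of the curve; the guard `lc(P)` is transported alongside:
**`exists_edgeTransport`**.  [folklore bookkeeping]; Mantova–Masser's question (PLMS 2024 §1
p. 5) stays OPEN; EC(3,2) OPEN; NOT Schanuel's conjecture (neither used nor implied); EAC ⇏ SC.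
-/

noncomputable section

open Polynomial
open Literature.ModelTheory.Zilber

set_option linter.dupNamespace false

namespace Summit.Schanuel.Schanuel.Theorems

section EdgeTransportPoly

/-! ## Part A. Row sums with prescribed exponents -/

/-- Evaluation of `Σ_{m ∈ s} C(a_m) X^{e_m}` after mapping the coefficients. [folklore] -/
theorem eval_map_sum_C_mul_X_pow {R : Type*} [CommSemiring R] {ι : Type*} (s : Finset ι)
    (a : ι → R) (e : ι → ℕ) (f : R →+* ℂ) (y : ℂ) :
    ((∑ m ∈ s, Polynomial.C (a m) * Polynomial.X ^ e m).map f).eval y =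
      ∑ m ∈ s, f (a m) * y ^ e m := by
  rw [Polynomial.map_sum, Polynomial.eval_finsetSum]
  refine Finset.sum_congr rfl fun m _ => ?_
  rw [Polynomial.map_mul, Polynomial.map_pow, Polynomial.map_C, Polynomial.map_X, Polynomial.eval_mul,
    Polynomial.eval_pow, Polynomial.eval_C, Polynomial.eval_X]

/-- Coefficients of `Σ_{m ∈ s} C(a_m) X^{e_m}`. [folklore] -/
theorem coeff_sum_C_mul_X_pow {R : Type*} [Semiring R] {ι : Type*} (s : Finset ι)
    (a : ι → R) (e : ι → ℕ) (t : ℕ) :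
    (∑ m ∈ s, Polynomial.C (a m) * Polynomial.X ^ e m).coeff t =
      ∑ m ∈ s, if t = e m then a m else 0 := by
  rw [Polynomial.finsetSum_coeff]
  exact Finset.sum_congr rfl fun m _ => Polynomial.coeff_C_mul_X_pow _ _ _

/-! ## Part B. The transport -/

variable (F : ℂ[X][X])

/-- **TRANSPORT OF A FIBRE RELATION TO ITS LOWER EDGE.**  See the module docstring.  Inputs:
`F` (the curve), `F₃` (= `F` in `ℂ[x₀, x₁, y₁]`), `P` of positive degree with `F₃ ∤ lc(P)`,
`F₃ ∤ P(0)`, and a sign function `sgn` with values `±1`.  Outputs: the edge `a ≥ 1`, `b`, `c`,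
`d` (`ad − bc = 1`), the sign `ε = sgn a b c d`, the row transport `τ` for
`V = (εd −b; −εc a)`, the transported relation `G'`, its degenerate part `G₀'` (two
coefficients `∉ (τF)`), the monomial exponents `n₀, n₁` of the evaluation identity, and the
transported guard rows `cQ` of `lc(P)`. [folklore] (new in this form) -/
theorem exists_edgeTransport (F₃ : MvPolynomial (Fin 3) ℂ)
    (hF₃ : ∀ v : Fin 3 → ℂ, MvPolynomial.eval v F₃ = (F.map (Polynomial.evalRingHom (v 0))).eval (v 1))
    (P : Polynomial (MvPolynomial (Fin 3) ℂ)) (hd : 1 ≤ P.natDegree)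
    (htop : ¬ F₃ ∣ P.leadingCoeff) (hbot : ¬ F₃ ∣ P.coeff 0)
    (sgn : ℤ → ℤ → ℤ → ℤ → ℤ) (hsgn : ∀ a b c d, sgn a b c d = 1 ∨ sgn a b c d = -1) :
    ∃ (a b c d ε : ℤ) (τ : ℂ[X][X] ≃+* ℂ[X][X]) (G' : Polynomial (MvPolynomial (Fin 3) ℂ))
      (G₀' cQ : Polynomial ℂ[X][X]) (n₀ n₁ : ℤ),
      1 ≤ a ∧ a * d - b * c = 1 ∧ ε = sgn a b c d ∧
      (∀ (G : ℂ[X][X]) (x : Fin 2 → ℂ), ((τ G).map (Polynomial.evalRingHom (x 0))).eval (x 1) =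
        (G.map (Polynomial.evalRingHom (intLinMap !![ε * d, -b; -ε * c, a] x 0))).eval
          (intLinMap !![ε * d, -b; -ε * c, a] x 1)) ∧
      (∀ x₀ x₁ y : ℂ, (G₀'.map (Polynomial.eval₂RingHom (Polynomial.evalRingHom x₀) x₁)).eval y =
        (G'.map (MvPolynomial.eval ![x₀, x₁, 0])).eval y) ∧
      (∃ i j, i < j ∧ ¬ τ F ∣ G₀'.coeff i ∧ ¬ τ F ∣ G₀'.coeff j) ∧
      (∀ (x : Fin 2 → ℂ) (Λ y : ℂ), Λ ≠ 0 → y ≠ 0 →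
        (F.map (Polynomial.evalRingHom (intLinMap !![ε * d, -b; -ε * c, a] x 0))).eval
          (intLinMap !![ε * d, -b; -ε * c, a] x 1) = 0 →
        (G'.map (MvPolynomial.eval ![x 0, x 1, y])).eval Λ =
          Λ ^ n₀ * y ^ n₁ * (P.map (MvPolynomial.eval ![intLinMap !![ε * d, -b; -ε * c, a] x 0,
            intLinMap !![ε * d, -b; -ε * c, a] x 1, Λ ^ (-(ε * c)) * y ^ a])).eval
              (Λ ^ (ε * d) * y ^ (-b))) ∧
      (∃ j, ¬ τ F ∣ cQ.coeff j) ∧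
      (∀ (x : Fin 2 → ℂ) (Λ y : ℂ), Λ ≠ 0 → y ≠ 0 →
        MvPolynomial.eval ![intLinMap !![ε * d, -b; -ε * c, a] x 0,
          intLinMap !![ε * d, -b; -ε * c, a] x 1, Λ ^ (-(ε * c)) * y ^ a] P.leadingCoeff =
        ∑ j ∈ Finset.range (cQ.natDegree + 1),
          (Polynomial.eval₂RingHom (Polynomial.evalRingHom (x 0)) (x 1)) (cQ.coeff j) *
            Λ ^ (-(ε * c) * (j : ℤ)) * y ^ (a * (j : ℤ))) := by
  classical
  obtain ⟨κ, hκ⟩ := exists_rowsEquiv₃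
  -- `κ⁻¹ (C F) = F₃`
  have hκF : κ.symm (Polynomial.C F) = F₃ := by
    refine MvPolynomial.funext fun v => ?_
    have e : v = ![v 0, v 1, v 2] := by funext i; fin_cases i <;> rfl
    rw [hF₃, e, hκ, RingEquiv.apply_symm_apply, Polynomial.map_C, Polynomial.eval_C,
      Polynomial.coe_eval₂RingHom, Polynomial.eval₂_eq_eval_map]
    rfl
  -- a coefficient `∉ (F₃)` has a row `∉ (F)`
  have hcol : ∀ cf : MvPolynomial (Fin 3) ℂ, ¬ F₃ ∣ cf →
      ∃ j, j ≤ (κ cf).natDegree ∧ ¬ F ∣ (κ cf).coeff j := by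
    intro cf hcf
    by_contra hall
    push Not at hall
    have hall' : ∀ j, F ∣ (κ cf).coeff j := by
      intro j
      by_cases hj : j ≤ (κ cf).natDegree
      · exact hall j hj
      · rw [Polynomial.coeff_eq_zero_of_natDegree_lt (by omega)]; exact dvd_zero F
    obtain ⟨T, hT⟩ := (Polynomial.C_dvd_iff_dvd_coeff F (κ cf)).2 hall'
    apply hcf
    refine ⟨κ.symm T, ?_⟩
    apply κ.injective
    rw [map_mul, RingEquiv.apply_symm_apply, ← hκF, RingEquiv.apply_symm_apply]
    exact hT
  -- rows and the support modulo `F`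
  set n : ℕ := P.natDegree with hn
  set Qi : ℕ → Polynomial ℂ[X][X] := fun i => κ (P.coeff i) with hQi
  set Pc : ℕ × ℕ → ℂ[X][X] := fun m => (Qi m.1).coeff m.2 with hPc
  set D : ℕ := (Finset.range (n + 1)).sup fun i => (Qi i).natDegree with hD
  have hDi : ∀ i ∈ Finset.range (n + 1), (Qi i).natDegree ≤ D :=
    fun i hi => Finset.le_sup (f := fun i => (Qi i).natDegree) hi
  set S : Finset (ℕ × ℕ) := ((Finset.range (n + 1)) ×ˢ (Finset.range (D + 1))).filter
    (fun m => ¬ F ∣ Pc m) with hS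
  have hmemS : ∀ m, m ∈ S ↔ (m.1 ≤ n ∧ m.2 ≤ D) ∧ ¬ F ∣ Pc m := by
    intro m
    rw [hS, Finset.mem_filter, Finset.mem_product, Finset.mem_range, Finset.mem_range]
    constructor
    · rintro ⟨⟨h1, h2⟩, h3⟩; exact ⟨⟨by omega, by omega⟩, h3⟩
    · rintro ⟨⟨h1, h2⟩, h3⟩; exact ⟨⟨by omega, by omega⟩, h3⟩
  -- two points of `S` with distinct first coordinates: `(0, j)` and `(n, j')`
  have hS2 : ∃ m₁ ∈ S, ∃ m₂ ∈ S, m₁.1 ≠ m₂.1 := by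
    obtain ⟨j, hj, hjF⟩ := hcol (P.coeff 0) hbot
    obtain ⟨j', hj', hj'F⟩ := hcol P.leadingCoeff htop
    have h0D : (Qi 0).natDegree ≤ D := hDi 0 (Finset.mem_range.2 (by omega))
    have hnD : (Qi n).natDegree ≤ D := hDi n (Finset.mem_range.2 (by omega))
    refine ⟨(0, j), (hmemS _).2 ⟨⟨by omega, ?_⟩, hjF⟩, (n, j'), (hmemS _).2 ⟨⟨le_rfl, ?_⟩, ?_⟩, ?_⟩
    · exact hj.trans h0D
    · have : (κ P.leadingCoeff).natDegree ≤ D := hnD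
      exact hj'.trans this
    · exact hj'F
    · simp only [ne_eq]; omega
  -- the lower edge
  obtain ⟨a, b, c, d, ha, hdet, m₁, hm₁, m₂, hm₂, hne, heq, hmin⟩ := exists_lowerEdge S hS2
  obtain ⟨ε, hεdef, hε⟩ : ∃ ε : ℤ, ε = sgn a b c d ∧ (ε = 1 ∨ ε = -1) := ⟨_, rfl, hsgn a b c d⟩
  have hε2 : ε * ε = 1 := by rcases hε with h | h <;> rw [h] <;> norm_num
  -- the matrices
  set U : Matrix (Fin 2) (Fin 2) ℤ := !![ε * a, ε * b; c, d] with hU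
  set V : Matrix (Fin 2) (Fin 2) ℤ := !![ε * d, -b; -ε * c, a] with hV
  have hUV : U * V = 1 := by
    have e1 : ε * a * (ε * d) + ε * b * (-ε * c) = 1 := by
      linear_combination (a * d - b * c) * hε2 + hdet
    have e2 : ε * a * -b + ε * b * a = 0 := by ring
    have e3 : c * (ε * d) + d * (-ε * c) = 0 := by ring
    have e4 : c * -b + d * a = 1 := by linear_combination hdet
    rw [hU, hV, Matrix.mul_fin_two, e1, e2, e3, e4, Matrix.one_fin_two]
  have hVU : V * U = 1 := by
    have e1 : ε * d * (ε * a) + -b * c = 1 := by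
      linear_combination (a * d) * hε2 + hdet
    have e2 : ε * d * (ε * b) + -b * d = 0 := by linear_combination (b * d) * hε2
    have e3 : -ε * c * (ε * a) + a * c = 0 := by linear_combination -(a * c) * hε2
    have e4 : -ε * c * (ε * b) + a * d = 1 := by linear_combination -(b * c) * hε2 + hdet
    rw [hU, hV, Matrix.mul_fin_two, e1, e2, e3, e4, Matrix.one_fin_two]
  obtain ⟨τ, hτ⟩ := exists_rowsTransport (U := U) (V := V) hUV hVU
  -- exponents
  set ℓ : ℕ × ℕ → ℤ := fun m => a * (m.2 : ℤ) - b * m.1 with hℓ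
  set ι : ℕ × ℕ → ℤ := fun m => ε * (d * (m.1 : ℤ) - c * m.2) with hι
  set ℓmin : ℤ := ℓ m₁ with hℓmin
  have hℓmin_le : ∀ m ∈ S, ℓmin ≤ ℓ m := fun m hm => hmin m hm
  set N₀ : ℕ := S.sup fun m => (ι m).natAbs with hN₀
  have hιN : ∀ m ∈ S, 0 ≤ ι m + N₀ := by
    intro m hm
    have h1 : (ι m).natAbs ≤ N₀ := Finset.le_sup (f := fun m => (ι m).natAbs) hm
    omega
  set e₀ : ℕ × ℕ → ℕ := fun m => (ι m + N₀).toNat with he₀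
  set e₁ : ℕ × ℕ → ℕ := fun m => (ℓ m - ℓmin).toNat with he₁
  have he₀z : ∀ m ∈ S, (e₀ m : ℤ) = ι m + N₀ := fun m hm => Int.toNat_of_nonneg (hιN m hm)
  have he₁z : ∀ m ∈ S, (e₁ m : ℤ) = ℓ m - ℓmin := fun m hm =>
    Int.toNat_of_nonneg (by linarith [hℓmin_le m hm])
  -- injectivity of `m ↦ (ι m, ℓ m)`
  have hinj : ∀ m m' : ℕ × ℕ, ℓ m = ℓ m' → ι m = ι m' → m = m' := by
    intro m m' h1 h2
    have hε0 : ε ≠ 0 := by rcases hε with h | h <;> rw [h] <;> norm_num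
    simp only [hℓ, hι] at h1 h2
    have h2' : d * (m.1 : ℤ) - c * m.2 = d * m'.1 - c * m'.2 := mul_left_cancel₀ hε0 h2
    have hi : (m.1 : ℤ) = m'.1 := by
      linear_combination a * h2' + c * h1 - ((m.1 : ℤ) - m'.1) * hdet
    have hj : (m.2 : ℤ) = m'.2 := by
      linear_combination b * h2' + d * h1 - ((m.2 : ℤ) - m'.2) * hdet
    exact Prod.ext (by exact_mod_cast hi) (by exact_mod_cast hj)
  -- the embedding of rows into `ℂ[x₀, x₁, y₁]`
  set emb : ℂ[X][X] →+* MvPolynomial (Fin 3) ℂ := κ.symm.toRingHom.comp Polynomial.C with hemb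
  have hembev : ∀ (H : ℂ[X][X]) (u v w : ℂ), MvPolynomial.eval ![u, v, w] (emb H) =
      (H.map (Polynomial.evalRingHom u)).eval v := by
    intro H u v w
    rw [hemb, RingHom.comp_apply, RingEquiv.toRingHom_eq_coe, RingEquiv.coe_toRingHom, hκ,
      RingEquiv.apply_symm_apply, Polynomial.map_C, Polynomial.eval_C, Polynomial.coe_eval₂RingHom,
      Polynomial.eval₂_eq_eval_map]
  -- the transported objects
  set G' : Polynomial (MvPolynomial (Fin 3) ℂ) := ∑ m ∈ S,
    Polynomial.C (emb (τ (Pc m)) * MvPolynomial.X 2 ^ e₁ m) * Polynomial.X ^ e₀ m with hG'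
  set G₀' : Polynomial ℂ[X][X] := ∑ m ∈ S.filter (fun m => ℓ m = ℓmin),
    Polynomial.C (τ (Pc m)) * Polynomial.X ^ e₀ m with hG₀'
  set cQ : Polynomial ℂ[X][X] := (κ P.leadingCoeff).map τ.toRingHom with hcQ
  -- divisibility transfer along `τ`
  have hτdvd : ∀ H : ℂ[X][X], τ F ∣ τ H → F ∣ H := by
    intro H h
    have := map_dvd τ.symm h
    simpa using this
  refine ⟨a, b, c, d, ε, τ, G', G₀', cQ, (N₀ : ℤ), -ℓmin, ha, hdet, hεdef, hτ, ?_, ?_, ?_, ?_, ?_⟩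
  · -- `G₀' = G'(·, 0; ·)`
    intro x₀ x₁ y
    rw [hG₀', hG', eval_map_sum_C_mul_X_pow, eval_map_sum_C_mul_X_pow, Finset.sum_filter]
    refine Finset.sum_congr rfl fun m hm => ?_
    rw [map_mul, map_pow, MvPolynomial.eval_X, hembev]
    simp only [Matrix.cons_val_two, Matrix.tail_cons, Matrix.head_cons, Polynomial.coe_eval₂RingHom,
      Polynomial.eval₂_eq_eval_map]
    by_cases h : ℓ m = ℓmin
    · have he : e₁ m = 0 := by simp [he₁, h]
      rw [if_pos h, he, pow_zero, mul_one]
    · have he : e₁ m ≠ 0 := by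
        intro h0
        have := he₁z m hm
        rw [h0] at this
        have := hℓmin_le m hm
        exact h (by push_cast at *; linarith)
      rw [if_neg h, zero_pow he, mul_zero, zero_mul]
  · -- two coefficients of `G₀'` not divisible by `τ F`
    have hm₁f : m₁ ∈ S.filter (fun m => ℓ m = ℓmin) := Finset.mem_filter.2 ⟨hm₁, rfl⟩
    have hm₂f : m₂ ∈ S.filter (fun m => ℓ m = ℓmin) := Finset.mem_filter.2 ⟨hm₂, heq.symm⟩
    have hcoef : ∀ m₀ ∈ S.filter (fun m => ℓ m = ℓmin), G₀'.coeff (e₀ m₀) = τ (Pc m₀) := by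
      intro m₀ hm₀
      rw [hG₀', coeff_sum_C_mul_X_pow, Finset.sum_eq_single_of_mem m₀ hm₀]
      · rw [if_pos rfl]
      · intro m hm hmm₀
        rw [if_neg]
        intro he
        obtain ⟨hmS, hmℓ⟩ := Finset.mem_filter.1 hm
        obtain ⟨hm₀S, hm₀ℓ⟩ := Finset.mem_filter.1 hm₀
        apply hmm₀
        refine hinj m m₀ (by rw [hmℓ, hm₀ℓ]) ?_
        have h1 := he₀z m hmS
        have h2 := he₀z m₀ hm₀S
        have : (e₀ m₀ : ℤ) = e₀ m := by exact_mod_cast he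
        linarith
    have hne₀ : e₀ m₁ ≠ e₀ m₂ := by
      intro he
      apply hne
      refine hinj m₁ m₂ heq ?_
      have h1 := he₀z m₁ hm₁
      have h2 := he₀z m₂ hm₂
      have : (e₀ m₁ : ℤ) = e₀ m₂ := by exact_mod_cast he
      linarith
    have hnd₁ : ¬ τ F ∣ G₀'.coeff (e₀ m₁) := by
      rw [hcoef m₁ hm₁f]; exact fun h => ((hmemS m₁).1 hm₁).2 (hτdvd _ h)
    have hnd₂ : ¬ τ F ∣ G₀'.coeff (e₀ m₂) := by
      rw [hcoef m₂ hm₂f]; exact fun h => ((hmemS m₂).1 hm₂).2 (hτdvd _ h)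
    rcases lt_or_gt_of_ne hne₀ with hlt | hgt
    · exact ⟨e₀ m₁, e₀ m₂, hlt, hnd₁, hnd₂⟩
    · exact ⟨e₀ m₂, e₀ m₁, hgt, hnd₂, hnd₁⟩
  · -- the evaluation identity on the torus, at points of the curve
    intro x Λ y hΛ hy hFx
    -- the left-hand side
    rw [hG', eval_map_sum_C_mul_X_pow]
    -- the right-hand side: expand `P` along rows and columns
    generalize hu : intLinMap V x 0 = u at hFx ⊢
    generalize hv : intLinMap V x 1 = v at hFx ⊢
    generalize hY₁ : Λ ^ (-(ε * c)) * y ^ a = Y₁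
    generalize hY₀ : Λ ^ (ε * d) * y ^ (-b) = Y₀
    have hrow : ∀ i ∈ Finset.range (n + 1), MvPolynomial.eval ![u, v, Y₁] (P.coeff i) =
        ∑ j ∈ Finset.range (D + 1),
          (Polynomial.eval₂RingHom (Polynomial.evalRingHom u) v) (Pc (i, j)) * Y₁ ^ j := by
      intro i hi
      rw [hκ, eval_map_eq_rowSum (κ (P.coeff i)) _ (hDi i hi)]
    have hP : (P.map (MvPolynomial.eval ![u, v, Y₁])).eval Y₀ =
        ∑ m ∈ S, (Polynomial.eval₂RingHom (Polynomial.evalRingHom u) v) (Pc m) * Y₁ ^ m.2 * Y₀ ^ m.1 := by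
      rw [eval_map_eq_rowSum P _ le_rfl]
      have h1 : ∑ i ∈ Finset.range (n + 1), MvPolynomial.eval ![u, v, Y₁] (P.coeff i) * Y₀ ^ i =
          ∑ m ∈ (Finset.range (n + 1)) ×ˢ (Finset.range (D + 1)),
            (Polynomial.eval₂RingHom (Polynomial.evalRingHom u) v) (Pc m) * Y₁ ^ m.2 * Y₀ ^ m.1 := by
        rw [Finset.sum_product]
        refine Finset.sum_congr rfl fun i hi => ?_
        rw [hrow i hi, Finset.sum_mul]
      rw [h1, hS, Finset.sum_filter_of_ne]
      intro m _ hm0 hdvd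
      apply hm0
      obtain ⟨H, hH⟩ := hdvd
      have hFuv : (Polynomial.eval₂RingHom (Polynomial.evalRingHom u) v) F = 0 := by
        rw [Polynomial.coe_eval₂RingHom, Polynomial.eval₂_eq_eval_map]; exact hFx
      rw [hH, map_mul, hFuv, zero_mul, zero_mul, zero_mul]
    rw [hP, Finset.mul_sum]
    refine Finset.sum_congr rfl fun m hm => ?_
    rw [map_mul, map_pow, MvPolynomial.eval_X, hembev, hτ, hu, hv]
    simp only [Matrix.cons_val_two, Matrix.tail_cons, Matrix.head_cons, Polynomial.coe_eval₂RingHom,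
      Polynomial.eval₂_eq_eval_map]
    -- exponent bookkeeping: `Λ^{e₀} y^{e₁} = Λ^{N₀} y^{-ℓmin} Y₁^j Y₀^i`
    have hΛe : (Λ ^ e₀ m : ℂ) = Λ ^ (ι m + N₀) := by rw [← zpow_natCast, he₀z m hm]
    have hye : (y ^ e₁ m : ℂ) = y ^ (ℓ m - ℓmin) := by rw [← zpow_natCast, he₁z m hm]
    have hY₁j : Y₁ ^ m.2 = Λ ^ (-(ε * c) * (m.2 : ℤ)) * y ^ (a * (m.2 : ℤ)) := by
      rw [← hY₁, mul_pow, ← zpow_natCast, ← zpow_natCast, ← zpow_mul, ← zpow_mul]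
    have hY₀i : Y₀ ^ m.1 = Λ ^ (ε * d * (m.1 : ℤ)) * y ^ (-b * (m.1 : ℤ)) := by
      rw [← hY₀, mul_pow, ← zpow_natCast, ← zpow_natCast, ← zpow_mul, ← zpow_mul]
    rw [hΛe, hye, hY₁j, hY₀i]
    have eΛ : Λ ^ (ι m + N₀) = Λ ^ (N₀ : ℤ) * (Λ ^ (-(ε * c) * (m.2 : ℤ)) * Λ ^ (ε * d * (m.1 : ℤ))) := by
      rw [← zpow_add₀ hΛ, ← zpow_add₀ hΛ]; congr 1; simp only [hι]; ring
    have ey : y ^ (ℓ m - ℓmin) = y ^ (-ℓmin) * (y ^ (a * (m.2 : ℤ)) * y ^ (-b * (m.1 : ℤ))) := by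
      rw [← zpow_add₀ hy, ← zpow_add₀ hy]; congr 1; simp only [hℓ]; ring
    rw [eΛ, ey]
    ring
  · -- the transported guard rows: some coefficient `∉ (τ F)`
    obtain ⟨j, -, hjF⟩ := hcol P.leadingCoeff htop
    refine ⟨j, ?_⟩
    rw [hcQ, Polynomial.coeff_map, RingEquiv.toRingHom_eq_coe, RingEquiv.coe_toRingHom]
    exact fun h => hjF (hτdvd _ h)
  · -- evaluation of the guard
    intro x Λ y hΛ hy
    have hdeg : cQ.natDegree = (κ P.leadingCoeff).natDegree := by
      rw [hcQ]; exact Polynomial.natDegree_map_eq_of_injective τ.injective _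
    rw [hκ, eval_map_eq_rowSum (κ P.leadingCoeff) _ le_rfl, hdeg]
    refine Finset.sum_congr rfl fun j _ => ?_
    rw [hcQ, Polynomial.coeff_map, RingEquiv.toRingHom_eq_coe, RingEquiv.coe_toRingHom]
    simp only [Polynomial.coe_eval₂RingHom, Polynomial.eval₂_eq_eval_map]
    rw [hτ, mul_pow, ← zpow_natCast (Λ ^ (-(ε * c))), ← zpow_natCast (y ^ a), ← zpow_mul, ← zpow_mul,
      mul_assoc]

end EdgeTransportPoly

end Summit.Schanuel.Schanuel.Theorems

end
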